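import Summits.BirchSwinnertonDyer.Rank1Residual.Additive.CyclotomicThreeMultiplicativeReduction
import Summits.BirchSwinnertonDyer.Rank1Residual.Partition.TamagawaHeegnerAnyPrime
import Literature.NumberTheory.EllipticCurves.Castella2018.TamagawaQuadraticBaseChangeProofs
import Literature.NumberTheory.EllipticCurves.ComplexMultiplicationDeuringLocalPlaces
import Literature.NumberTheory.EllipticCurves.SerreOpenImageOrdinaryInertiaProofs
import Literature.NumberTheory.EllipticCurves.ModularityVersionApProofs
import Literature.NumberTheory.EllipticCurves.HeegnerPoints
import Literature.NumberTheory.Automorphic.AdicCompletionDegreeOnePlaceProofs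
import Literature.NumberTheory.DiophantineGeometry.MinimalDiscriminantRingOfIntegersProofs
import Literature.NumberTheory.EllipticCurves.Milne1972.WeilRestrictionQuadraticBSDQuotientOfAnyModelProofs
import HarnessLib

/-!
# Route `CMKolyvaginAtInertTwo` (rung W-ALL/12.K12-2), crux `CMExactDescentAtTwo`
# (item stmt-BirchSwinnertonDyer-22837) — LOCAL LEMMA: the base change `W ⊗ K` of a `ℤ`-minimal
# model to a Heegner field is MINIMAL AT EVERY FINITE PLACE, hence Dokchitser–Dokchitser's
# `C(W ⊗ K) = ∏_w c_w(E_K) = (∏_ℓ c_ℓ(E))²` `p`-adically for EVERY prime `p` (including `p = 2`)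

HONEST FRAMING (cell `bsd-print-cf2`, HOME `run/shared/lean/pub/bsd-print-cf2/`, seat
`bsd-line-cmk2-p1`; line `route-BirchSwinnertonDyer-CMKolyvaginAtInertTwo` on the leaf
`WAllCornerFTwo`): THEOREMS ONLY — no definition, no named fact, nothing asserted, nothing booked.
BSD is not proved by this; no class of the corner is closed here. This file supplies the kernel
obligation K7 (a) of the cell's DOSSIER §21 for the descent item `CMExactDescentAtTwo`: the
model-free over-`K` input `MissingPPartOverCAt (W.baseChange K) 2` of
`AdditivePotMult.bsdp_of_pPartOverC_baseChange` is stated with Dokchitser–Dokchitser's modified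
Tamagawa product `C(W ⊗ K) = ∏_w c_w |ω/ω_w°|_w`, and the correction factors `|ω/ω_w°|_w` are all
`1` exactly when the model `W ⊗ K` is minimal at `w`. For a globally minimal `W/ℚ` of conductor
`N` and a quadratic field `K` in which EVERY prime `ℓ ∣ N` SPLITS (the classical Heegner hypothesis)
this holds at every finite place `w` of `K`:

* `isMinimalAt_baseChange_of_degree_one` — at a place `w` of degree one (`e(w|ℓ) = f(w|ℓ) = 1`)
  minimality is TRANSPORTED from `ℚ_ℓ` along the isomorphism `ℚ_ℓ ≃ K_w` of the tree
  (`exists_ringEquiv_adicCompletion_of_ramificationIdx_eq_one_of_inertiaDeg_eq_one`,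
  `WeierstrassCurve.isMinimal_map_ringEquiv`; Silverman *AEC* VII.1, VIII.8);
* `isMinimalAt_baseChange_of_not_dvd_conductorNorm` — above a prime `ℓ ∤ N` of good reduction the
  `ℤ`-minimal equation has unit discriminant at `w`, hence is minimal (AEC VII.1 Remark 1.1);
* `isMinimalAt_baseChange_of_heegner` — under the Heegner hypothesis every place is of one of the
  two kinds (a prime `ℓ ∣ N` splits, so its places have degree one;
  `placesOver_trichotomy_of_finrank_eq_two`), so `W ⊗ K` is minimal at EVERY finite place, and
  `isGloballyMinimal_baseChange_of_heegner` packages this as the instance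
  `(W.baseChange K).IsGloballyMinimal` (the standing instance binder of the sub-lane «bsd-p2»'s
  `P2/HeegnerIndexAtTwoOverKDescent.lean`, there "not re-proved, certified per pair by Tate's
  algorithm over `K`" — now a theorem for Heegner fields);
* `padicValRat_modifiedTamagawaProduct_baseChange_of_heegner` — consequently, for EVERY prime `p`,
  `ord_p C(W ⊗ K) = ord_p ∏_w c_w(E_K) = 2 · ord_p ∏_ℓ c_ℓ(E)` (tree:
  `Additive.padicValRat_modifiedTamagawaProduct_baseChange_of_isMinimalAt`,
  `X11b.padicValNat_tamagawaProduct_baseChange_eq_two_mul_of_allSplit`, JSW 2017 (eq:tamK));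
* `modifiedTamagawaProduct_baseChange_eq_sq_of_heegner` — and exactly `C(W ⊗ K) = (∏_ℓ c_ℓ(E))²`.

References: [SilvermanAEC2009] VII.1 Prop. 1.3, Remark 1.1, VIII.8; [DokchitserDokchitserAnnals2010]
§1 Notation; [JetchevSkinnerWan2017] §7.3.1 (eq:tamK); [GrossLMS1991] §1 (1.2); cell DOSSIER §21
(K7 (a)); `Milne1972/WeilRestrictionQuadraticBSDQuotientAnyModel.lean` (why `C` and not `∏ c_w`).
-/

set_option autoImplicit false
-- the Theorems namespace of this sub repeats the summit name by design (D-0017 nested layout)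
set_option linter.dupNamespace false

noncomputable section

open scoped Classical

open WeierstrassCurve NumberField IsDedekindDomain Literature.NumberTheory.EllipticCurves
  Literature.NumberTheory.EllipticCurves.Rank1Residual
  Summit.BirchSwinnertonDyer.Rank1Residual

namespace Summit.BirchSwinnertonDyer.BirchSwinnertonDyer.Theorems.CMExactDescent

variable (W : WeierstrassCurve ℚ) [W.IsElliptic] [W.IsGloballyMinimal]
  (K : Type) [Field K] [NumberField K]

/-! ## §1 Minimality of `W ⊗ K` at a place of degree one and above a good prime -/

omit [W.IsElliptic] in
/-- **Minimality is inherited at a place of degree one.** For `W/ℚ` globally minimal, a number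
field `K` and a finite place `w` of `K` with `e(w|ℓ) = f(w|ℓ) = 1` over the prime `ℓ` below it,
the model `W ⊗ K` is a minimal Weierstrass equation at `w`: `K_w ≃ ℚ_ℓ` compatibly with the
valuation rings (`exists_ringEquiv_adicCompletion_of_ramificationIdx_eq_one_of_inertiaDeg_eq_one`),
`(W ⊗ K) ⊗ K_w` is the image of `W ⊗ ℚ_ℓ`, and Mathlib's `IsMinimal` is transported along such
isomorphisms (`WeierstrassCurve.isMinimal_map_ringEquiv`); `W ⊗ ℚ_ℓ` is minimal by global
minimality (Silverman *AEC* VIII.8). [cite: SilvermanAEC2009, VII.1 Prop. 1.3 and VIII.8] -/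
theorem isMinimalAt_baseChange_of_degree_one (w : HeightOneSpectrum (𝓞 K))
    (he : w.asIdeal.ramificationIdx (𝓞 ℚ) = 1) (hf : w.asIdeal.inertiaDeg (𝓞 ℚ) = 1) :
    (W.baseChange K).IsMinimalAt w := by
  set v : HeightOneSpectrum (𝓞 ℚ) := w.under (𝓞 ℚ) with hv
  haveI : w.asIdeal.LiesOver v.asIdeal := ⟨rfl⟩
  obtain ⟨ψ, φ, hc, hφ⟩ :=
    Literature.NumberTheory.Automorphic.exists_ringEquiv_adicCompletion_of_ramificationIdx_eq_one_of_inertiaDeg_eq_one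
      ℚ K v w he hf
  have hX : (W.baseChange K).baseChange (w.adicCompletion K) =
      (W.baseChange (v.adicCompletion ℚ)).map (φ : v.adicCompletion ℚ →+* w.adicCompletion K) := by
    simp only [baseChange, map_map]
    congr 1
    refine RingHom.ext fun x ↦ ?_
    simp only [RingHom.coe_comp, Function.comp_apply, RingHom.coe_coe]
    exact (hφ x).symm
  haveI : (W.baseChange (v.adicCompletion ℚ)).IsMinimal (v.adicCompletionIntegers ℚ) :=
    IsGloballyMinimal.isMinimal v
  show ((W.baseChange K).baseChange (w.adicCompletion K)).IsMinimal (w.adicCompletionIntegers K)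
  rw [hX]
  exact isMinimal_map_ringEquiv ψ φ hc _

/-- The rational prime below a finite place `w` of `K` (membership form): if `(ℓ) ⊆ w` then the
place of `ℚ` under `w` is the place `v_ℓ` (`Rat.HeightOneSpectrum.primesEquiv`). [folklore] -/
theorem under_eq_primesEquiv_symm_of_mem (w : HeightOneSpectrum (𝓞 K)) {ℓ : ℕ} (hℓ : ℓ.Prime)
    (hℓw : (ℓ : 𝓞 K) ∈ w.asIdeal) :
    w.under (𝓞 ℚ) = (Rat.HeightOneSpectrum.primesEquiv (R := 𝓞 ℚ)).symm ⟨ℓ, hℓ⟩ := by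
  apply (natCast_mem_asIdeal_iff_eq_primesEquiv_symm (w.under (𝓞 ℚ)) hℓ).mp
  rw [HeightOneSpectrum.under_asIdeal, Ideal.under_def, Ideal.mem_comap, map_natCast]
  exact hℓw

/-- **Above a prime `ℓ ∤ N` the `ℤ`-minimal model stays minimal.** For `W/ℚ` globally minimal of
conductor `N` and a finite place `w` of `K` above a prime `ℓ ∤ N`: `W` has good reduction at `ℓ`
(`dvd_conductorNorm_iff_not_hasGoodReductionAtPrime`), so `ℓ ∤ Δ_min(W)`
(`not_dvd_minimalDiscriminantInt_of_hasGoodReductionAtPrime'`), `v_w(Δ(W ⊗ K)) = 0` and the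
`w`-integral equation `W ⊗ K` is minimal at `w` (AEC VII.1 Remark 1.1,
`isMinimalAt_of_lt_valuation_Δ_holds`). [cite: SilvermanAEC2009, VII.1 Remark 1.1 and VII.5 Prop. 5.1(a)] -/
theorem isMinimalAt_baseChange_of_not_dvd_conductorNorm (w : HeightOneSpectrum (𝓞 K))
    {ℓ : ℕ} (hℓ : ℓ.Prime) (hℓw : (ℓ : 𝓞 K) ∈ w.asIdeal) (hℓN : ¬ ℓ ∣ W.conductorNorm ℤ) :
    (W.baseChange K).IsMinimalAt w := by
  haveI : Fact ℓ.Prime := ⟨hℓ⟩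
  have hgood : W.HasGoodReductionAtPrime ℓ := by
    by_contra hbad
    exact hℓN ((W.dvd_conductorNorm_iff_not_hasGoodReductionAtPrime ℓ).mpr hbad)
  have hΔ : ¬ (ℓ : ℤ) ∣ minimalDiscriminantInt W :=
    W.not_dvd_minimalDiscriminantInt_of_hasGoodReductionAtPrime' ℓ hgood
  have hval : w.valuation K (W.baseChange K).Δ = 1 := by
    rw [← Additive.baseChange_integralModelInt_eq W]
    exact valuation_Δ_baseChange_int_eq_one (integralModelInt W) w hℓ hℓw hΔ
  have hint : (W.baseChange K).IsIntegralAt w := by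
    rw [← Additive.baseChange_integralModelInt_eq W]
    exact isIntegralAt_baseChange_intModel (integralModelInt W) w
  refine isMinimalAt_of_lt_valuation_Δ_holds hint ?_
  rw [hval, ← WithZero.exp_zero, WithZero.exp_lt_exp]
  norm_num

/-! ## §2 Under the Heegner hypothesis `W ⊗ K` is minimal at every finite place -/

/-- **Minimality of `W ⊗ K` at EVERY finite place of a Heegner field.** `W/ℚ` globally minimal of
conductor `N`, `K` quadratic (`[K:ℚ] = 2`) in which every prime `ℓ ∣ N` splits
(`SatisfiesHeegnerHypothesis N K`). Let `w` be a finite place of `K` above `ℓ`. If `ℓ ∣ N` then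
`ℓ` splits, so `w` has degree one (the inert and ramified cases of
`placesOver_trichotomy_of_finrank_eq_two` have ONE place above `ℓ`, contradicting
`#{primes over ℓ} = 2`, `ncard_primesOver_span_eq`) and `isMinimalAt_baseChange_of_degree_one`
applies; if `ℓ ∤ N`, `isMinimalAt_baseChange_of_not_dvd_conductorNorm` applies. (Néron models of
`ℤ`-minimal equations commute with the étale base change `ℤ_ℓ → 𝒪_w`; here only the two elementary
cases are needed.) [cite: SilvermanAEC2009, VII.1 Prop. 1.3, Remark 1.1 and VIII.8]
[cite: GrossLMS1991, §1 (K = ℚ(√−D) with all prime factors of N split)] -/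
theorem isMinimalAt_baseChange_of_heegner (h2 : Module.finrank ℚ K = 2)
    (hH : SatisfiesHeegnerHypothesis (W.conductorNorm ℤ) K) (w : HeightOneSpectrum (𝓞 K)) :
    (W.baseChange K).IsMinimalAt w := by
  obtain ⟨ℓ, hℓ, hℓw⟩ : ∃ ℓ : ℕ, ℓ.Prime ∧ (ℓ : 𝓞 K) ∈ w.asIdeal :=
    ⟨_, Nat.absNorm_under_prime w.asIdeal, Int.absNorm_under_mem w.asIdeal⟩
  by_cases hℓN : ℓ ∣ W.conductorNorm ℤ
  · -- `ℓ` splits in `K`: `w` has degree one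
    set v : HeightOneSpectrum (𝓞 ℚ) := (Rat.HeightOneSpectrum.primesEquiv (R := 𝓞 ℚ)).symm ⟨ℓ, hℓ⟩
      with hvdef
    have hwv : w.under (𝓞 ℚ) = v := under_eq_primesEquiv_symm_of_mem K w hℓ hℓw
    have hvℓ : (Rat.HeightOneSpectrum.primesEquiv v : ℕ) = ℓ := by
      rw [hvdef, Equiv.apply_symm_apply]
    have hsplit : ((Ideal.span {(ℓ : ℤ)}).primesOver (𝓞 K)).ncard = 2 := hH ℓ hℓ hℓN
    have hcount : {w' : HeightOneSpectrum (𝓞 K) | w'.under (𝓞 ℚ) = v}.ncard = 2 := by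
      rw [← Literature.NumberTheory.EllipticCurves.Castella2018.TamagawaQuadratic.ncard_primesOver_span_eq
        K v, hvℓ]
      exact hsplit
    rcases placesOver_trichotomy_of_finrank_eq_two K h2 v with
      ⟨w₁, w₂, -, -, hef⟩ | ⟨w₀, hset, -, -⟩ | ⟨w₀, hset, -, -⟩
    · obtain ⟨he, hf⟩ := hef w hwv
      exact isMinimalAt_baseChange_of_degree_one W K w he hf
    · exfalso
      rw [hset, Set.ncard_singleton] at hcount
      exact absurd hcount (by decide)
    · exfalso
      rw [hset, Set.ncard_singleton] at hcount
      exact absurd hcount (by decide)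
  · exact isMinimalAt_baseChange_of_not_dvd_conductorNorm W K w hℓ hℓw hℓN

omit [W.IsElliptic] in
/-- `W ⊗ K` is `𝓞_K`-integral for a globally minimal (hence `ℤ`-integral) `W/ℚ`. [folklore] -/
theorem isIntegral_baseChange_ringOfIntegers : (W.baseChange K).IsIntegral (𝓞 K) := by
  rw [← Additive.baseChange_integralModelInt_eq W]
  exact isIntegral_of_exists_lift (𝓞 K) ⟨((integralModelInt W).a₁ : 𝓞 K), by simp [baseChange]⟩
    ⟨((integralModelInt W).a₂ : 𝓞 K), by simp [baseChange]⟩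
    ⟨((integralModelInt W).a₃ : 𝓞 K), by simp [baseChange]⟩
    ⟨((integralModelInt W).a₄ : 𝓞 K), by simp [baseChange]⟩
    ⟨((integralModelInt W).a₆ : 𝓞 K), by simp [baseChange]⟩

/-- **`W ⊗ K` is a GLOBAL MINIMAL MODEL over a Heegner field.** For `W/ℚ` globally minimal of
conductor `N` and a quadratic field `K` in which every `ℓ ∣ N` splits, the base-changed equation
`W.baseChange K` is globally minimal over `K` (`WeierstrassCurve.IsGloballyMinimal`: `𝓞_K`-integral
and minimal at every finite place, `isMinimalAt_baseChange_of_heegner`). Discharges, for Heegner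
fields, the standing instance binder `[(W.baseChange K).IsGloballyMinimal]` of the sub-lane
«bsd-p2»'s descent theorems (`P2/HeegnerIndexAtTwoOverKDescent.lean`). [cite: SilvermanAEC2009, VIII.8 (global minimal models)] -/
theorem isGloballyMinimal_baseChange_of_heegner (h2 : Module.finrank ℚ K = 2)
    (hH : SatisfiesHeegnerHypothesis (W.conductorNorm ℤ) K) :
    (W.baseChange K).IsGloballyMinimal where
  isIntegral := isIntegral_baseChange_ringOfIntegers W K
  isMinimal w := isMinimalAt_baseChange_of_heegner W K h2 hH w

/-! ## §3 The modified Tamagawa product of `W ⊗ K`, `p`-adically and exactly -/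

/-- **`ord_p C(W ⊗ K) = 2 · ord_p ∏_ℓ c_ℓ(E)` for EVERY prime `p` at a Heegner field.** For
`W/ℚ` globally minimal of conductor `N`, `K` quadratic with every `ℓ ∣ N` split, and any prime
`p`: Dokchitser–Dokchitser's `C(W ⊗ K) = ∏_w c_w |ω/ω_w°|_w` has `ord_p C(W ⊗ K) = ord_p ∏_w c_w(E_K)`
(all corrections are `1` at the places above `p`, where `W ⊗ K` is minimal —
`isMinimalAt_baseChange_of_heegner` — and odd-prime powers elsewhere;
`Additive.padicValRat_modifiedTamagawaProduct_baseChange_of_isMinimalAt`), and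
`∏_w c_w(E_K) = (∏_ℓ c_ℓ(E))²` (`X11b.tamagawaProduct_baseChange_eq_sq_of_allSplit`, JSW 2017
(eq:tamK)). At `p = 2` with `∏_ℓ c_ℓ(E)` odd: `ord₂ C(W ⊗ K) = 0`.
[cite: DokchitserDokchitserAnnals2010, §1 Notation (arXiv pp. 4–5)]
[cite: JetchevSkinnerWan2017, §7.3.1 (eq:tamK)] -/
theorem padicValRat_modifiedTamagawaProduct_baseChange_of_heegner (p : ℕ) [Fact p.Prime]
    (h2 : Module.finrank ℚ K = 2) (hH : SatisfiesHeegnerHypothesis (W.conductorNorm ℤ) K) :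
    padicValRat p (W.baseChange K).modifiedTamagawaProduct =
      2 * padicValNat p W.tamagawaProduct := by
  have hsplit : ∀ (ℓ : ℕ) [Fact ℓ.Prime], ℓ ∣ W.conductorNorm ℤ → X11b.SplitsIn K ℓ :=
    fun ℓ _ hℓN ↦ hH ℓ Fact.out hℓN
  rw [Additive.padicValRat_modifiedTamagawaProduct_baseChange_of_isMinimalAt W p
      (fun w _ ↦ isMinimalAt_baseChange_of_heegner W K h2 hH w),
    X11b.padicValNat_tamagawaProduct_baseChange_eq_two_mul_of_allSplit W K p h2 hsplit]
  push_cast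
  ring

/-- **`C(W ⊗ K) = (∏_ℓ c_ℓ(E))²` exactly at a Heegner field** (globally minimal `W ⊗ K`:
`modifiedTamagawaProduct_eq_tamagawaProduct_of_isGloballyMinimal`, then (eq:tamK)).
[cite: DokchitserDokchitserAnnals2010, §1 Notation (arXiv pp. 4–5)]
[cite: JetchevSkinnerWan2017, §7.3.1 (eq:tamK)] -/
theorem modifiedTamagawaProduct_baseChange_eq_sq_of_heegner (h2 : Module.finrank ℚ K = 2)
    (hH : SatisfiesHeegnerHypothesis (W.conductorNorm ℤ) K) :
    (W.baseChange K).modifiedTamagawaProduct = ((W.tamagawaProduct ^ 2 : ℕ) : ℚ) := by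
  haveI : (W.baseChange K).IsElliptic := by rw [baseChange]; infer_instance
  haveI := isGloballyMinimal_baseChange_of_heegner W K h2 hH
  have hsplit : ∀ (ℓ : ℕ) [Fact ℓ.Prime], ℓ ∣ W.conductorNorm ℤ → X11b.SplitsIn K ℓ :=
    fun ℓ _ hℓN ↦ hH ℓ Fact.out hℓN
  rw [(W.baseChange K).modifiedTamagawaProduct_eq_tamagawaProduct_of_isGloballyMinimal,
    X11b.tamagawaProduct_baseChange_eq_sq_of_allSplit W K h2 hsplit]

end Summit.BirchSwinnertonDyer.BirchSwinnertonDyer.Theorems.CMExactDescent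

end
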